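import Literature.NumberTheory.EllipticCurves.MazurTorsionLocalStepsProofs
import Literature.NumberTheory.EllipticCurves.HasseElementary
import HarnessLib

/-!
# Mazur 1977, Ch. III §5, Step 2 with the Riemann hypothesis: `N ≤ 1 + q + 2√q`

Sibling proof file (theorems only) of `MazurTorsionLocalStepsProofs`, for the prime-case leaf
`Literature.NumberTheory.EllipticCurves.Mazur1977_no_prime_torsion W` (B. Mazur, *Modular curves
and the Eisenstein ideal*, Publ. Math. IHÉS 47 (1977), Ch. III §5, pp. 156–160).

The first sentence of the proof of Step 2 (p. 159) reads: "If `E_{/𝔽_q}` were an elliptic curve,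
and `ℤ/N ⊂ E_{/𝔽_q}`, then by the 'Riemann hypothesis' `N ≤ 1 + q + 2√q`, which is impossible
for `q = 2, 3`." `MazurTorsionLocalStepsProofs` formalised Step 2 with the trivial count
`#Ẽ_ns(𝔽_q) ≤ 2q + 1` in place of the Riemann hypothesis (enough for `q = 2, 3`). The tree now
proves Hasse's theorem for elliptic curves over finite fields of characteristic `≠ 2, 3`
(`WeierstrassCurve.abs_natCard_point_sub_le_of_ringChar_ne`, Manin's elementary proof,
`HasseElementary`), and this file records Mazur's sentence in printed strength together with its
consequence for the putative curve of the leaf: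

* `addOrderOf_le_hasse_of_isUnit_Δ`, `addOrderOf_le_hasse_of_hasGoodReduction` — over a local
  ring `R ⊂ K` (resp. a discrete valuation ring) with finite residue field `k` of characteristic
  `≠ 2, 3` and an equation with good reduction: a `K`-point killed by an integer `n` which is a
  unit of `R` has order `≤ #k + 1 + 2√#k` (`⟨P⟩ ↪ Ẽ(k)`, *AEC* VII.3.1, and Hasse);
* `Mazur1977_stepTwo_hasse` — for `E/ℚ` with a rational point of prime order `N` and a prime `q`
  of good reduction, `N ≤ q + 1 + 2√q` (all primes `q`: for `q = 2, 3` the trivial count gives the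
  same bound, and `q = N` is trivial);
* `Mazur1977_hasMultiplicativeReductionAtPrime_of_hasse_lt` — hence (with Step 1,
  `Mazur1977_stepOne_padic`) `E` has multiplicative reduction at every prime `q` with
  `q + 1 + 2√q < N`; in the scope of the leaf (`N = 11` or `N ≥ 17`) at every prime `q ≤ 5`
  (`Mazur1977_hasMultiplicativeReductionAtPrime_of_le_five`; the trivial count reaches `q = 5`
  only for `N ≥ 13`).

## References

* [Mazur1977] B. Mazur, *Modular curves and the Eisenstein ideal*, Publ. Math. IHÉS 47 (1977),
  Ch. III §5, Step 2, p. 159.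
* [SilvermanAEC2009] J. H. Silverman, *The Arithmetic of Elliptic Curves*, 2nd ed. (2009),
  Thm. V.1.1 (Hasse), VII.2.1, VII.3.1, VII.5.1.

## Design

No definitions; `noncomputable section`, `open scoped Classical` as in the sibling files; finite
residue fields enter as `[Finite k]` with bounds in `Nat.card k`, cast to `ℝ` for `2√q`.
-/

noncomputable section

open scoped Classical

namespace Literature.NumberTheory.EllipticCurves

open _root_.WeierstrassCurve

/-! ## §1 Good reduction over a local ring: `ord P ≤ #k + 1 + 2√#k` -/

section Local

variable {K : Type*} [Field K] {Γ₀ : Type*} [LinearOrderedCommGroupWithZero Γ₀]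
  {v : Valuation K Γ₀} {R : Type*} [CommRing R] [IsLocalRing R] [Algebra R K]
  {W : WeierstrassCurve R}

/-- **`⟨P⟩ ↪ Ẽ(k)` and the Riemann hypothesis** (Mazur 1977, p. 159, first sentence of the
proof of Step 2; Silverman, *AEC*, VII.3.1(b) and V.1.1): for an equation `W` over a valuation
ring `R` of `K` with unit discriminant and finite residue field `k` of characteristic `≠ 2, 3`,
a `K`-point `P` with `n • P = O` and `v n = 1` has order at most `#Ẽ(k) ≤ #k + 1 + 2√#k`.
[cite: Mazur1977, Ch. III §5, Step 2, p. 159; SilvermanAEC2009, Thm. V.1.1 and Prop. VII.3.1(b)] -/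
theorem addOrderOf_le_hasse_of_isUnit_Δ (hv : v.Integers R) (hΔ : IsUnit W.Δ)
    [Finite (IsLocalRing.ResidueField R)]
    (h2 : ringChar (IsLocalRing.ResidueField R) ≠ 2)
    (h3 : ringChar (IsLocalRing.ResidueField R) ≠ 3)
    {P : (W.baseChange K).toAffine.Point} {n : ℤ} (hn : v (n : K) = 1) (hnP : n • P = 0) :
    (addOrderOf P : ℝ) ≤ Nat.card (IsLocalRing.ResidueField R) + 1 +
      2 * Real.sqrt (Nat.card (IsLocalRing.ResidueField R)) := by
  haveI := Fintype.ofFinite (IsLocalRing.ResidueField R)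
  haveI : (W.map (IsLocalRing.residue R)).IsElliptic := isElliptic_map_residue hΔ
  haveI : Finite (W.map (IsLocalRing.residue R)).toAffine.Point := finite_point _
  have h1 : addOrderOf P ≤ Nat.card (W.map (IsLocalRing.residue R)).toAffine.Point :=
    addOrderOf_le_natCard_of_hasNonsingularReduction hv
      (hasNonsingularReduction_of_isUnit_Δ hv hΔ P) hn hnP
  have h1' : (addOrderOf P : ℝ) ≤ Nat.card (W.map (IsLocalRing.residue R)).toAffine.Point := by
    exact_mod_cast h1
  have hH := (abs_le.mp
    ((W.map (IsLocalRing.residue R)).abs_natCard_point_sub_le_of_ringChar_ne h2 h3)).2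
  rw [Nat.card_eq_fintype_card (α := IsLocalRing.ResidueField R)]
  linarith

/-- The trivial companion for all characteristics (used at `q = 2, 3`): under the same
hypotheses except on the characteristic, the order of `P` is at most `#Ẽ(k) ≤ 2·#k + 1`.
[cite: SilvermanAEC2009, Prop. VII.3.1(b)] -/
theorem addOrderOf_le_two_mul_card_add_one_of_isUnit_Δ (hv : v.Integers R) (hΔ : IsUnit W.Δ)
    [Finite (IsLocalRing.ResidueField R)]
    {P : (W.baseChange K).toAffine.Point} {n : ℤ} (hn : v (n : K) = 1) (hnP : n • P = 0) :
    addOrderOf P ≤ 2 * Nat.card (IsLocalRing.ResidueField R) + 1 := by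
  haveI := Fintype.ofFinite (IsLocalRing.ResidueField R)
  haveI : Finite (W.map (IsLocalRing.residue R)).toAffine.Point := finite_point _
  calc addOrderOf P ≤ Nat.card (W.map (IsLocalRing.residue R)).toAffine.Point :=
        addOrderOf_le_natCard_of_hasNonsingularReduction hv
          (hasNonsingularReduction_of_isUnit_Δ hv hΔ P) hn hnP
    _ ≤ 2 * Fintype.card (IsLocalRing.ResidueField R) + 1 :=
        natCard_point_le_two_mul_card_add_one' _
    _ = 2 * Nat.card (IsLocalRing.ResidueField R) + 1 := by rw [Nat.card_eq_fintype_card]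

end Local

/-! ## §2 Discrete valuation rings: the same for a model with good reduction -/

section DVR

variable (R : Type*) [CommRing R] [IsDomain R] [IsDiscreteValuationRing R]
  {K : Type*} [Field K] [Algebra R K] [IsFractionRing R K] (W : WeierstrassCurve K)

/-- A model with good reduction (Mathlib's `HasGoodReduction`: minimal with `v(Δ) = 1`) is the
base change of an `R`-model with unit discriminant. [cite: SilvermanAEC2009, Prop. VII.5.1(a)] -/
theorem exists_eq_baseChange_isUnit_Δ_of_hasGoodReduction [W.HasGoodReduction R] :
    ∃ W₀ : WeierstrassCurve R, W = W₀.baseChange K ∧ IsUnit W₀.Δ := by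
  have hgood : IsDedekindDomain.HeightOneSpectrum.valuation K
      (IsDiscreteValuationRing.maximalIdeal R) W.Δ = 1 := HasGoodReduction.goodReduction
  obtain ⟨W₀, rfl⟩ : ∃ W₀ : WeierstrassCurve R, W = W₀.baseChange K := IsIntegral.integral
  refine ⟨W₀, rfl, ?_⟩
  have h1 : (W₀.baseChange K).Δ = algebraMap R K W₀.Δ := W₀.map_Δ (algebraMap R K)
  rw [h1, IsDedekindDomain.HeightOneSpectrum.valuation_eq_one_iff_notMem] at hgood
  by_contra hu
  exact hgood ((IsLocalRing.mem_maximalIdeal _).mpr hu)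

/-- **Step 2 with the Riemann hypothesis, over a discrete valuation ring** with finite residue
field `k` of characteristic `≠ 2, 3`: on a model with good reduction, a point `P` with
`n • P = O`, `n` non-zero in `k`, has order `≤ #k + 1 + 2√#k`.
[cite: Mazur1977, Ch. III §5, Step 2, p. 159; SilvermanAEC2009, Thm. V.1.1 and Prop. VII.3.1(b)] -/
theorem addOrderOf_le_hasse_of_hasGoodReduction [W.HasGoodReduction R]
    [Finite (IsLocalRing.ResidueField R)]
    (h2 : ringChar (IsLocalRing.ResidueField R) ≠ 2)
    (h3 : ringChar (IsLocalRing.ResidueField R) ≠ 3)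
    {P : W.toAffine.Point} {n : ℤ} (hn : (n : IsLocalRing.ResidueField R) ≠ 0) (hnP : n • P = 0) :
    (addOrderOf P : ℝ) ≤ Nat.card (IsLocalRing.ResidueField R) + 1 +
      2 * Real.sqrt (Nat.card (IsLocalRing.ResidueField R)) := by
  obtain ⟨W₀, hW, hΔ⟩ := exists_eq_baseChange_isUnit_Δ_of_hasGoodReduction R W
  subst hW
  have hv := integers_valuationRing_valuation R K
  have hn' : ValuationRing.valuation R K (n : K) = 1 := by
    rw [show (n : K) = algebraMap R K (n : R) by simp, v_algebraMap_eq_one_iff hv]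
    simpa using hn
  exact addOrderOf_le_hasse_of_isUnit_Δ hv hΔ h2 h3 hn' hnP

/-- The trivial companion over a discrete valuation ring (all characteristics): on a model with
good reduction, a point `P` with `n • P = O`, `n` non-zero in `k`, has order `≤ 2·#k + 1`.
[cite: SilvermanAEC2009, Prop. VII.3.1(b)] -/
theorem addOrderOf_le_two_mul_card_add_one_of_hasGoodReduction [W.HasGoodReduction R]
    [Finite (IsLocalRing.ResidueField R)]
    {P : W.toAffine.Point} {n : ℤ} (hn : (n : IsLocalRing.ResidueField R) ≠ 0) (hnP : n • P = 0) :
    addOrderOf P ≤ 2 * Nat.card (IsLocalRing.ResidueField R) + 1 := by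
  obtain ⟨W₀, hW, hΔ⟩ := exists_eq_baseChange_isUnit_Δ_of_hasGoodReduction R W
  subst hW
  have hv := integers_valuationRing_valuation R K
  have hn' : ValuationRing.valuation R K (n : K) = 1 := by
    rw [show (n : K) = algebraMap R K (n : R) by simp, v_algebraMap_eq_one_iff hv]
    simpa using hn
  exact addOrderOf_le_two_mul_card_add_one_of_isUnit_Δ hv hΔ hn' hnP

end DVR

/-! ## §3 Over `ℚ`: `N ≤ q + 1 + 2√q` at every prime of good reduction -/

section Rat

variable (W : WeierstrassCurve ℚ) [W.IsElliptic] (q : ℕ) [Fact q.Prime]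

/-- The residue field of `ℤ_q` has characteristic `q` (a local copy of the statement of
`BSDRootNumber.lean`, whose analytic imports are not wanted here). [folklore] -/
private theorem ringChar_residueField_padicInt' : ringChar (IsLocalRing.ResidueField ℤ_[q]) = q := by
  refine ringChar.eq_iff.mpr ⟨fun n => ?_⟩
  rw [← ZMod.natCast_eq_zero_iff, ← map_natCast (PadicInt.residueField (p := q)) n,
    map_eq_zero_iff _ (PadicInt.residueField (p := q)).injective]

omit [W.IsElliptic] in
/-- `√q ≤ 2` gives `2q + 1 ≤ q + 1 + 2√q` for `q ≤ 4`: the trivial count is as good as Hasse at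
`q = 2, 3`. [folklore] -/
theorem two_mul_add_one_le_hasse {q : ℕ} (hq : q ≤ 4) :
    (2 * q + 1 : ℝ) ≤ q + 1 + 2 * Real.sqrt q := by
  have hs : 0 ≤ Real.sqrt q := Real.sqrt_nonneg _
  have hsq : Real.sqrt q ^ 2 = q := Real.sq_sqrt (Nat.cast_nonneg _)
  have hq' : (q : ℝ) ≤ 4 := by exact_mod_cast hq
  have hs2 : Real.sqrt q ≤ 2 := by
    rw [show (2 : ℝ) = Real.sqrt 4 by rw [show (4 : ℝ) = 2 ^ 2 by norm_num, Real.sqrt_sq (by norm_num)]]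
    exact Real.sqrt_le_sqrt hq'
  nlinarith [mul_le_mul_of_nonneg_left hs2 hs]

omit [W.IsElliptic] in
/-- **Mazur 1977, Ch. III §5, Step 2, first sentence, in printed strength**: "If `E_{/𝔽_q}`
were an elliptic curve, and `ℤ/N ⊂ E_{/𝔽_q}`, then by the 'Riemann hypothesis'
`N ≤ 1 + q + 2√q`." For an elliptic curve `E/ℚ` with a rational point of prime order `N` and a
prime `q` at which `E` has good reduction, `N ≤ q + 1 + 2√q`. Proof: for `q = N` there is
nothing to show; otherwise the point, transported to the `ℤ_q`-minimal model of `E ⊗ ℚ_q`,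
generates a subgroup mapping injectively into `Ẽ(𝔽_q)` (*AEC* VII.3.1(b)), of order
`≤ q + 1 + 2√q` by Hasse's theorem (tree `abs_natCard_point_sub_le_of_ringChar_ne`, for
`q ≠ 2, 3`) or by the trivial count `2q + 1 ≤ q + 1 + 2√q` (`q = 2, 3`).
[cite: Mazur1977, Ch. III §5, Step 2, p. 159; SilvermanAEC2009, Thm. V.1.1 and Prop. VII.3.1(b)] -/
theorem Mazur1977_stepTwo_hasse {N : ℕ} (hN : N.Prime) {P : W.toAffine.Point}
    (hP : addOrderOf P = N) (hgood : W.HasGoodReductionAtPrime q) :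
    (N : ℝ) ≤ q + 1 + 2 * Real.sqrt q := by
  have hs : 0 ≤ Real.sqrt q := Real.sqrt_nonneg _
  rcases eq_or_ne q N with rfl | hqN
  · linarith
  haveI : ((W.baseChange ℚ_[q]).minimal ℤ_[q]).HasGoodReduction ℤ_[q] := hgood
  haveI : Finite (IsLocalRing.ResidueField ℤ_[q]) :=
    Finite.of_equiv (ZMod q) (PadicInt.residueField (p := q)).symm.toEquiv
  set P' : ((W.baseChange ℚ_[q]).minimal ℤ_[q]).toAffine.Point :=
    VariableChange.pointEquiv (W.baseChange ℚ_[q])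
      ((W.baseChange ℚ_[q]).exists_isMinimal ℤ_[q]).choose
      (Affine.Point.map (W' := W.toAffine) (S := ℚ) (Algebra.ofId ℚ ℚ_[q]) P) with hP'
  have hP'ord : addOrderOf P' = N :=
    ((AddEquiv.addOrderOf_eq _ _).trans (addOrderOf_injective _
      (Affine.Point.map_injective (W' := W.toAffine) (f := Algebra.ofId ℚ ℚ_[q])) P)).trans hP
  have hNk : ((N : ℤ) : IsLocalRing.ResidueField ℤ_[q]) ≠ 0 := by
    exact_mod_cast natCast_residueField_padicInt_ne_zero q hN hqN
  have hNP' : (N : ℤ) • P' = 0 := by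
    rw [natCast_zsmul, ← hP'ord]; exact addOrderOf_nsmul_eq_zero P'
  have hcard : Nat.card (IsLocalRing.ResidueField ℤ_[q]) = q := natCard_residueField_padicInt q
  by_cases hq4 : q ≤ 4
  · have h := addOrderOf_le_two_mul_card_add_one_of_hasGoodReduction ℤ_[q]
      ((W.baseChange ℚ_[q]).minimal ℤ_[q]) hNk hNP'
    rw [hP'ord, hcard] at h
    have h' : (N : ℝ) ≤ 2 * q + 1 := by exact_mod_cast h
    exact h'.trans (two_mul_add_one_le_hasse hq4)
  · have hq2 : ringChar (IsLocalRing.ResidueField ℤ_[q]) ≠ 2 := by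
      rw [ringChar_residueField_padicInt']; omega
    have hq3 : ringChar (IsLocalRing.ResidueField ℤ_[q]) ≠ 3 := by
      rw [ringChar_residueField_padicInt']; omega
    have h := addOrderOf_le_hasse_of_hasGoodReduction ℤ_[q]
      ((W.baseChange ℚ_[q]).minimal ℤ_[q]) hq2 hq3 hNk hNP'
    rwa [hP'ord, hcard] at h

omit [W.IsElliptic] in
/-- Integer form: at a prime `q` of good reduction with `q + 1 ≤ N`, `(N - q - 1)² ≤ 4q`.
[cite: Mazur1977, Ch. III §5, Step 2, p. 159; SilvermanAEC2009, Thm. V.1.1] -/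
theorem Mazur1977_stepTwo_hasse_sq {N : ℕ} (hN : N.Prime) {P : W.toAffine.Point}
    (hP : addOrderOf P = N) (hgood : W.HasGoodReductionAtPrime q) (hle : q + 1 ≤ N) :
    (N - (q + 1)) ^ 2 ≤ 4 * q := by
  have h := Mazur1977_stepTwo_hasse W q hN hP hgood
  have hs : 0 ≤ Real.sqrt q := Real.sqrt_nonneg _
  have hsq : Real.sqrt q ^ 2 = q := Real.sq_sqrt (Nat.cast_nonneg _)
  have h0 : ((N - (q + 1) : ℕ) : ℝ) = N - (q + 1) := by
    rw [Nat.cast_sub hle]; push_cast; ring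
  have h1 : (0 : ℝ) ≤ N - (q + 1) := by
    have : ((q + 1 : ℕ) : ℝ) ≤ N := by exact_mod_cast hle
    push_cast at this; linarith
  have h2 : ((N - (q + 1) : ℕ) : ℝ) ^ 2 ≤ 4 * q := by
    rw [h0]; nlinarith
  exact_mod_cast h2

omit [W.IsElliptic] in
/-- **Bad reduction at every prime `q` with `q + 1 + 2√q < N`** for an elliptic curve over `ℚ`
with a rational point of prime order `N` (contrapositive of `Mazur1977_stepTwo_hasse`).
[cite: Mazur1977, Ch. III §5, Step 2, p. 159] -/
theorem Mazur1977_not_hasGoodReductionAtPrime_of_hasse_lt {N : ℕ} (hN : N.Prime)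
    {P : W.toAffine.Point} (hP : addOrderOf P = N) (hq : (q : ℝ) + 1 + 2 * Real.sqrt q < N) :
    ¬ W.HasGoodReductionAtPrime q := fun hgood =>
  (not_le.mpr hq) (Mazur1977_stepTwo_hasse W q hN hP hgood)

/-- **Multiplicative reduction at every prime `q` with `q + 1 + 2√q < N`** (Mazur 1977, Ch. III
§5, Steps 1 and 2 up to its first sentence, in printed strength): for an elliptic curve `E/ℚ`
with a rational point of prime order `N ≥ 5`, every prime `q` with `q + 1 + 2√q < N` (so
`q ≠ N`) is a prime of multiplicative reduction — not good by the Riemann hypothesis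
(`Mazur1977_stepTwo_hasse`), not additive by Step 1 (`Mazur1977_stepOne_padic`).
[cite: Mazur1977, Ch. III §5, Steps 1–2, pp. 158–159] -/
theorem Mazur1977_hasMultiplicativeReductionAtPrime_of_hasse_lt {N : ℕ} (hN : N.Prime)
    (h5 : 5 ≤ N) {P : W.toAffine.Point} (hP : addOrderOf P = N)
    (hq : (q : ℝ) + 1 + 2 * Real.sqrt q < N) : W.HasMultiplicativeReductionAtPrime q := by
  have hqN : q ≠ N := by
    rintro rfl
    have := Real.sqrt_nonneg (q : ℝ)
    linarith
  haveI : (W.baseChange ℚ_[q]).IsElliptic := inferInstanceAs (W.map (algebraMap ℚ ℚ_[q])).IsElliptic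
  rcases hasGoodReduction_or_hasMultiplicativeReduction_or_hasAdditiveReduction ℤ_[q]
      (W := (W.baseChange ℚ_[q]).minimal ℤ_[q]) with hg | hm | ha
  · exact absurd hg (Mazur1977_not_hasGoodReductionAtPrime_of_hasse_lt W q hN hP hq)
  · exact hm
  · exact absurd ha (Mazur1977_stepOne_padic W q hN h5 hP hqN)

/-- **In the scope of the prime-case leaf** (`N` prime, `N ∉ {2, 3, 5, 7, 13}`, so `N ≥ 11`):
a rational point of order `N` forces multiplicative reduction at every prime `q` with
`q + 1 + 2√q < N`. [cite: Mazur1977, Ch. III §5, Steps 1–2, pp. 158–159] -/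
theorem Mazur1977_hasMultiplicativeReductionAtPrime_of_hasse_lt' {N : ℕ} (hN : N.Prime)
    (hNS : N ∉ ({2, 3, 5, 7, 13} : Finset ℕ)) {P : W.toAffine.Point} (hP : addOrderOf P = N)
    (hq : (q : ℝ) + 1 + 2 * Real.sqrt q < N) : W.HasMultiplicativeReductionAtPrime q :=
  Mazur1977_hasMultiplicativeReductionAtPrime_of_hasse_lt W q hN
    (le_trans (by norm_num) (eleven_le_of_prime_of_not_mem hN hNS)) hP hq

/-- **Multiplicative reduction at `2`, `3` and `5`** in the scope of the leaf: an elliptic curve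
over `ℚ` with a rational point of prime order `N ∉ {2, 3, 5, 7, 13}` (so `N ≥ 11`) has
multiplicative reduction at every prime `q ≤ 5`, since `q + 1 + 2√q ≤ 6 + 2√5 < 11 ≤ N`. At
`q = 5` this needs the Riemann hypothesis (`#Ẽ(𝔽₅) ≤ 10`; the trivial count `≤ 11` does not
exclude `N = 11`); at `q = 2, 3` it is also in `MazurTorsionLocalStepsProofs`.
[cite: Mazur1977, Ch. III §5, Steps 1–2, pp. 158–159] -/
theorem Mazur1977_hasMultiplicativeReductionAtPrime_of_le_five {N : ℕ} (hN : N.Prime)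
    (hNS : N ∉ ({2, 3, 5, 7, 13} : Finset ℕ)) {P : W.toAffine.Point} (hP : addOrderOf P = N)
    (hq5 : q ≤ 5) : W.HasMultiplicativeReductionAtPrime q := by
  have h11 : (11 : ℝ) ≤ N := by exact_mod_cast eleven_le_of_prime_of_not_mem hN hNS
  refine Mazur1977_hasMultiplicativeReductionAtPrime_of_hasse_lt' W q hN hNS hP ?_
  have hs : 0 ≤ Real.sqrt q := Real.sqrt_nonneg _
  have hsq : Real.sqrt q ^ 2 = q := Real.sq_sqrt (Nat.cast_nonneg _)
  have hq' : (q : ℝ) ≤ 5 := by exact_mod_cast hq5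
  have hs5 : Real.sqrt q < 5 / 2 := by nlinarith
  linarith

end Rat

end Literature.NumberTheory.EllipticCurves

end
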